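import Mathlib
import HarnessLib
import Summits.HubbardSuperconductivity.HubbardSuperconductivity.Theorems.KLProgrammeMuOfDopingWindowFillingUpper
import Summits.HubbardSuperconductivity.HubbardSuperconductivity.Theorems.KLProgrammeMuOfDopingWindowFillingLower

/-!
# Route `WeakCouplingBCS` — two certified free fillings placing the level window `[-21/50, -7/20]` of the
# R2d door inside the doping window `[0.10, 0.35]` of the leaf `H1TwoPointLimitKLScaleD`:
# `13/20 ≤ n(-21/50)` and `n(-7/20) ≤ 9/10`

Cell `gate-hubbard-kl`, seat `hubbard-kl-h1-p1`.  The `δ → μ` transport of the rung-R2d leaf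
(`R2dH1.control_on_muWindow_of_fillings`, `…Theorems.WeakCouplingBCSH1TwoPointLimitKLScaleDPlumbing`) puts the leaf's conclusion on a
`μ`-window `[μ₁, μ₂]` as soon as the free fillings of the nearest-neighbour band `ε₀ = squareDispersion 1 0` satisfy
`13/20 ≤ n(μ₁)` and `n(μ₂) ≤ 9/10`.  The door `…Theorems.WeakCouplingBCSH1TwoPointLimitKLScaleDDoor` uses the level window
`[-21/50, -7/20]` (inside the certificate window `[-0.42749, -0.1775]` of R2d's certificate half and inside the thin-sufficiency window
`[-21/25, -7/20]` of crux 4).  This file certifies the two endpoint fillings (true values `n(-0.42) = 0.8026`, `n(-0.35) = 0.8289`),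
by the polygon method of S0 (`KLProgrammeMuOfDopingWindowFilling{Upper,Lower}`), `n(μ) = 2 vol({ε₀ < μ} ∩ BZ)/(2π)²`
(`kl_mu_filling_eq`):

* `klwU_filling_le : n(-7/20) ≤ 9/10` — the Fermi sea `{cos x + cos y > 7/40}` lies in the octagon `{|x|, |y| < 64/25,
  |x| + |y| < 149/50}` (`cos (64/25) ≤ -33/40`, `cos (149/100) ≤ 7/80`, degree-`8` Taylor majorant), covered by a box and two
  trapezoids of total area `21319/1250 = 17.0552 < 1.8 π²` (`π > 3.1415`);
* `klwL_filling_ge : 13/20 ≤ n(-21/50)` — the octagon with vertices `(±11/5, ±31/50)`, `(±31/50, ±11/5)` is inscribed in the convex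
  Fermi sea `{|x+y| < π, |x-y| < π, cos x + cos y > 21/100}` (degree-`10` Taylor minorant at the vertices; convexity
  `convex_fermiSeaCoord`), three symmetric trapezoids of total area `17959/1250 = 14.3672 > 1.3 π²` (`π < 3.1416`).

Folklore; no definitions; margins `4 %` and `12 %`.
-/

noncomputable section

set_option linter.dupNamespace false

namespace Summit.HubbardSuperconductivity.HubbardSuperconductivity.Theorems

open MeasureTheory Set Literature.MathematicalPhysics.QuantumLattice

/-! ### Upper bound `n(-7/20) ≤ 9/10`: the circumscribed octagon -/

/-- `cos (64/25) ≤ -33/40` (`cos 2.56 = -0.8356…`). [folklore] -/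
theorem klwU_cos_le : Real.cos (64 / 25) ≤ -(33 : ℝ) / 40 := by
  have h := cos_le_taylor_eight_real (64 / 25 : ℝ)
  norm_num at h
  linarith

/-- `cos (149/100) ≤ 7/80` (`cos 1.49 = 0.0807…`). [folklore] -/
theorem klwU_cos_half_le : Real.cos (149 / 100) ≤ 7 / 80 := by
  have h := cos_le_taylor_eight_real (149 / 100 : ℝ)
  norm_num at h
  linarith

/-- If `|x| ≤ π` and `cos x > -33/40` then `|x| < 64/25`. [folklore] -/
theorem klwU_abs_lt {x : ℝ} (hx : |x| ≤ Real.pi) (hc : -(33 : ℝ) / 40 < Real.cos x) : |x| < 64 / 25 := by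
  rcases lt_or_ge |x| (64 / 25) with h | h
  · exact h
  · exfalso
    have := Real.cos_le_cos_of_nonneg_of_le_pi (by norm_num) hx h
    rw [Real.cos_abs] at this
    linarith [klwU_cos_le]

/-- For `a, b ∈ [0, π]` with `cos a + cos b > 7/40` one has `a + b < 149/50`. [folklore] -/
theorem klwU_add_lt {a b : ℝ} (ha0 : 0 ≤ a) (haπ : a ≤ Real.pi) (hb0 : 0 ≤ b) (hbπ : b ≤ Real.pi)
    (h : 7 / 40 < Real.cos a + Real.cos b) : a + b < 149 / 50 := by
  rcases lt_or_ge (a + b) (149 / 50) with hD | hD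
  · exact hD
  · exfalso
    rw [Real.cos_add_cos] at h
    have hu : Real.cos ((a + b) / 2) ≤ 7 / 80 :=
      (Real.cos_le_cos_of_nonneg_of_le_pi (by norm_num) (by linarith) (by linarith)).trans
        klwU_cos_half_le
    have hv0 : 0 ≤ Real.cos ((a - b) / 2) :=
      Real.cos_nonneg_of_mem_Icc ⟨by linarith [Real.pi_pos], by linarith [Real.pi_pos]⟩
    have hv1 := Real.cos_le_one ((a - b) / 2)
    nlinarith [mul_nonneg (sub_nonneg.2 hu) hv0]

/-- Octagon containment of the Fermi sea at energy `-7/20`, in coordinates: an occupied momentum `p` of the Brillouin zone has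
`|p₀| < 64/25`, `|p₁| < 64/25` and `|p₀| + |p₁| < 149/50`. [folklore] -/
theorem klwU_occupied_coords {p : Momentum}
    (hp : p ∈ {p : Momentum | squareDispersion 1 0 p < -(7 : ℝ) / 20} ∩ brillouinZone) :
    |p 0| < 64 / 25 ∧ |p 1| < 64 / 25 ∧ |p 0| + |p 1| < 149 / 50 := by
  obtain ⟨hp1, hp2⟩ := hp
  simp only [mem_setOf_eq, squareDispersion] at hp1
  have hsum : 7 / 40 < Real.cos (p 0) + Real.cos (p 1) := by linarith
  have habs : ∀ i, |p i| ≤ Real.pi := fun i => by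
    have := hp2 i
    rw [abs_le]
    exact ⟨this.1, this.2.le⟩
  refine ⟨klwU_abs_lt (habs 0) (by linarith [Real.cos_le_one (p 1)]),
    klwU_abs_lt (habs 1) (by linarith [Real.cos_le_one (p 0)]), ?_⟩
  rw [← Real.cos_abs (p 0), ← Real.cos_abs (p 1)] at hsum
  exact klwU_add_lt (abs_nonneg _) (habs 0) (abs_nonneg _) (habs 1) hsum

/-- The Fermi sea at energy `-7/20`, in the coordinates `(p₀, p₁)`, lies in the union of the box
`(-21/50, 21/50) × (-64/25, 64/25)` and the two trapezoids `{21/50 ≤ x ≤ 64/25, |y| < 149/50 - x}`,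
`{-64/25 ≤ x ≤ -21/50, |y| < 149/50 + x}`. [folklore] -/
theorem klwU_occupied_subset_preimage :
    {p : Momentum | squareDispersion 1 0 p < -(7 : ℝ) / 20} ∩ brillouinZone ⊆
      (fun k : Momentum => ((k 0, k 1) : ℝ × ℝ)) ⁻¹'
        ((Ioo (-(21 / 50 : ℝ)) (21 / 50) ×ˢ Ioo (-(64 / 25 : ℝ)) (64 / 25)) ∪
          regionBetween (fun x : ℝ => x - 149 / 50) (fun x => 149 / 50 - x)
            (Icc (21 / 50) (64 / 25)) ∪
          regionBetween (fun x : ℝ => -x - 149 / 50) (fun x => x + 149 / 50)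
            (Icc (-(64 / 25)) (-(21 / 50)))) := by
  intro p hp
  obtain ⟨h0, h1, hs⟩ := klwU_occupied_coords hp
  rw [abs_lt] at h0 h1
  simp only [mem_preimage, mem_union, mem_prod, mem_Ioo, regionBetween, mem_setOf_eq, mem_Icc]
  rcases le_or_gt (p 0) (-(21 / 50)) with hlo | hlo
  · -- left trapezoid
    right
    rw [abs_of_neg (by linarith)] at hs
    have := abs_lt.1 (show |p 1| < 149 / 50 + p 0 by linarith)
    exact ⟨⟨by linarith, by linarith⟩, by linarith, by linarith⟩
  rcases le_or_gt (21 / 50) (p 0) with hhi | hhi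
  · -- right trapezoid
    left; right
    rw [abs_of_pos (by linarith)] at hs
    have := abs_lt.1 (show |p 1| < 149 / 50 - p 0 by linarith)
    exact ⟨⟨by linarith, by linarith⟩, by linarith, by linarith⟩
  · -- central box
    left; left
    exact ⟨⟨by linarith, by linarith⟩, by linarith, by linarith⟩

/-- The union of the three pieces is measurable. [folklore] -/
theorem klwU_measurableSet_pieces :
    MeasurableSet
      ((Ioo (-(21 / 50 : ℝ)) (21 / 50) ×ˢ Ioo (-(64 / 25 : ℝ)) (64 / 25)) ∪
        regionBetween (fun x : ℝ => x - 149 / 50) (fun x => 149 / 50 - x)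
          (Icc (21 / 50) (64 / 25)) ∪
        regionBetween (fun x : ℝ => -x - 149 / 50) (fun x => x + 149 / 50)
          (Icc (-(64 / 25)) (-(21 / 50)))) := by
  refine ((measurableSet_Ioo.prod measurableSet_Ioo).union ?_).union ?_
  · exact measurableSet_regionBetween (by fun_prop) (by fun_prop) measurableSet_Icc
  · exact measurableSet_regionBetween (by fun_prop) (by fun_prop) measurableSet_Icc

/-- Area of the central box: `(42/50) · (128/25) = 2688/625`. [folklore] -/
theorem klwU_volume_box :
    volume (Ioo (-(21 / 50 : ℝ)) (21 / 50) ×ˢ Ioo (-(64 / 25 : ℝ)) (64 / 25)) =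
      ENNReal.ofReal (2688 / 625) := by
  rw [Measure.volume_eq_prod, Measure.prod_prod, Real.volume_Ioo, Real.volume_Ioo,
    ← ENNReal.ofReal_mul (by norm_num)]
  congr 1
  norm_num

/-- `∫_{21/50}^{64/25} (149/25 - 2x) dx = 15943/2500`. [folklore] -/
theorem klwU_integral_right :
    ∫ x in (21 / 50 : ℝ)..(64 / 25), ((149 / 25 : ℝ) - 2 * x) = 15943 / 2500 := by
  rw [intervalIntegral.integral_sub intervalIntegrable_const
      (Continuous.intervalIntegrable (by fun_prop) _ _),
    intervalIntegral.integral_const, intervalIntegral.integral_const_mul, integral_id]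
  norm_num

/-- `∫_{-64/25}^{-21/50} (149/25 + 2x) dx = 15943/2500`. [folklore] -/
theorem klwU_integral_left :
    ∫ x in (-(64 / 25) : ℝ)..(-(21 / 50)), ((149 / 25 : ℝ) + 2 * x) = 15943 / 2500 := by
  rw [intervalIntegral.integral_add intervalIntegrable_const
      (Continuous.intervalIntegrable (by fun_prop) _ _),
    intervalIntegral.integral_const, intervalIntegral.integral_const_mul, integral_id]
  norm_num

/-- Area of the right trapezoid `{21/50 ≤ x ≤ 64/25, |y| < 149/50 - x}`: `15943/2500`. [folklore] -/
theorem klwU_volume_right :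
    volume (regionBetween (fun x : ℝ => x - 149 / 50) (fun x => 149 / 50 - x)
      (Icc (21 / 50) (64 / 25))) = ENNReal.ofReal (15943 / 2500) := by
  rw [Measure.volume_eq_prod, volume_regionBetween_eq_integral
    (Continuous.integrableOn_Icc (by fun_prop)) (Continuous.integrableOn_Icc (by fun_prop))
    measurableSet_Icc (fun x hx => by simp only [mem_Icc] at hx; linarith)]
  congr 1
  have hfun : ((fun x : ℝ => 149 / 50 - x) - fun x : ℝ => x - 149 / 50) =
      fun x => (149 / 25 : ℝ) - 2 * x := by
    funext x
    simp only [Pi.sub_apply]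
    ring
  rw [hfun, integral_Icc_eq_integral_Ioc, ← intervalIntegral.integral_of_le (by norm_num),
    klwU_integral_right]

/-- Area of the left trapezoid `{-64/25 ≤ x ≤ -21/50, |y| < 149/50 + x}`: `15943/2500`. [folklore] -/
theorem klwU_volume_left :
    volume (regionBetween (fun x : ℝ => -x - 149 / 50) (fun x => x + 149 / 50)
      (Icc (-(64 / 25)) (-(21 / 50)))) = ENNReal.ofReal (15943 / 2500) := by
  rw [Measure.volume_eq_prod, volume_regionBetween_eq_integral
    (Continuous.integrableOn_Icc (by fun_prop)) (Continuous.integrableOn_Icc (by fun_prop))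
    measurableSet_Icc (fun x hx => by simp only [mem_Icc] at hx; linarith)]
  congr 1
  have hfun : ((fun x : ℝ => x + 149 / 50) - fun x : ℝ => -x - 149 / 50) =
      fun x => (149 / 25 : ℝ) + 2 * x := by
    funext x
    simp only [Pi.sub_apply]
    ring
  rw [hfun, integral_Icc_eq_integral_Ioc, ← intervalIntegral.integral_of_le (by norm_num),
    klwU_integral_left]

/-- Total area of the three pieces: at most `2688/625 + 2 · 15943/2500 = 21319/1250`. [folklore] -/
theorem klwU_volume_pieces_le :
    volume
      ((Ioo (-(21 / 50 : ℝ)) (21 / 50) ×ˢ Ioo (-(64 / 25 : ℝ)) (64 / 25)) ∪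
        regionBetween (fun x : ℝ => x - 149 / 50) (fun x => 149 / 50 - x)
          (Icc (21 / 50) (64 / 25)) ∪
        regionBetween (fun x : ℝ => -x - 149 / 50) (fun x => x + 149 / 50)
          (Icc (-(64 / 25)) (-(21 / 50)))) ≤ ENNReal.ofReal (21319 / 1250) := by
  refine (measure_union_le _ _).trans ?_
  refine (add_le_add (measure_union_le _ _) le_rfl).trans ?_
  rw [klwU_volume_box, klwU_volume_right, klwU_volume_left,
    ← ENNReal.ofReal_add (by norm_num) (by norm_num), ← ENNReal.ofReal_add (by norm_num) (by norm_num)]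
  exact ENNReal.ofReal_le_ofReal (by norm_num)

/-- The occupied volume at energy `-7/20` is at most the octagon area `21319/1250 = 17.0552`. [folklore] -/
theorem klwU_volume_occupied_le :
    (volume ({p : Momentum | squareDispersion 1 0 p < -(7 : ℝ) / 20} ∩ brillouinZone)).toReal ≤
      21319 / 1250 := by
  refine ENNReal.toReal_le_of_le_ofReal (by norm_num) ?_
  refine (measure_mono klwU_occupied_subset_preimage).trans ?_
  rw [measurePreserving_momentum_prod.measure_preimage klwU_measurableSet_pieces.nullMeasurableSet]
  exact klwU_volume_pieces_le

/-- **Certified upper filling bound at the upper end of the door's level window**: `n(-7/20) ≤ 9/10`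
(`vol ≤ 17.0552 < 1.8 π²`, `π > 3.1415`; true value `n(-0.35) = 0.8289`). [folklore] -/
theorem klwU_filling_le :
    KohnLuttinger.filling (squareDispersion 1 0) (-(7 : ℝ) / 20) ≤ 9 / 10 := by
  rw [kl_mu_filling_eq]
  have hV := klwU_volume_occupied_le
  have hpi := Real.pi_gt_d4
  have hpi2 : (3.1415 : ℝ) * 3.1415 < Real.pi * Real.pi :=
    mul_self_lt_mul_self (by norm_num) hpi
  rw [div_le_iff₀ (by positivity)]
  nlinarith

/-! ### Lower bound `13/20 ≤ n(-21/50)`: the inscribed octagon -/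

/-- Vertex `(11/5, 31/50)` of the inscribed octagon lies in the Fermi sea at `c = 21/100`
(`cos 2.2 + cos 0.62 = 0.2254 > 0.21`, degree-`10` Taylor minorant). [folklore] -/
theorem klwL_vertex :
    ((11 / 5 : ℝ), (31 / 50 : ℝ)) ∈ {q : ℝ × ℝ | |q.1 + q.2| < Real.pi ∧ |q.1 - q.2| < Real.pi ∧
      21 / 100 < Real.cos q.1 + Real.cos q.2} := by
  refine mem_fermiSeaCoord ?_ ?_
  · rw [abs_of_nonneg (by norm_num), abs_of_nonneg (by norm_num)]; linarith [Real.pi_gt_d2]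
  · have h1 := taylor_ten_le_cos (11 / 5 : ℝ)
    have h2 := taylor_ten_le_cos (31 / 50 : ℝ)
    norm_num at h1 h2 ⊢
    linarith

/-- **The inscribed octagon**: the Fermi sea `{|x+y| < π, |x-y| < π, cos x + cos y > 21/100}` has area at least
`17959/1250 = 14.3672` (three symmetric trapezoids over the `x`-intervals between the nodes `-11/5, -31/50, 31/50, 11/5`, inscribed
by convexity). [folklore] -/
theorem klwL_le_volume_fermiSeaCoord :
    ENNReal.ofReal (17959 / 1250) ≤ volume {q : ℝ × ℝ | |q.1 + q.2| < Real.pi ∧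
      |q.1 - q.2| < Real.pi ∧ 21 / 100 < Real.cos q.1 + Real.cos q.2} := by
  have hconv := convex_fermiSeaCoord (show (0 : ℝ) < 21 / 100 by norm_num)
  -- the corners `(∓11/5, ±31/50)`, `(∓31/50, ±11/5)`
  have m0 := fermiSeaCoord_neg_fst klwL_vertex
  have n0 := fermiSeaCoord_neg_snd m0
  have m1 := fermiSeaCoord_neg_fst (fermiSeaCoord_swap klwL_vertex)
  have n1 := fermiSeaCoord_neg_snd m1
  have m2 := fermiSeaCoord_swap klwL_vertex
  have n2 := fermiSeaCoord_neg_snd m2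
  have m3 := klwL_vertex
  have n3 := fermiSeaCoord_neg_snd m3
  -- piece 1: x ∈ (-(11/5), -(31/50)], area (79/50)(141/50) = 11139/2500
  have hP1 := trapezoid_subset_of_convex hconv (by norm_num) m0 n0 m1 n1
  have hV1 := volume_trapezoid (x₀ := -(11/5)) (x₁ := -(31/50)) (y₀ := 31/50) (y₁ := 11/5)
    (by norm_num) (by norm_num) (by norm_num)
  -- piece 2: x ∈ (-(31/50), 31/50], area (62/50)(22/5) = 682/125
  have hP2 := trapezoid_subset_of_convex hconv (by norm_num) m1 n1 m2 n2
  have hV2 := volume_trapezoid (x₀ := -(31/50)) (x₁ := 31/50) (y₀ := 11/5) (y₁ := 11/5)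
    (by norm_num) (by norm_num) (by norm_num)
  -- piece 3: x ∈ (31/50, 11/5], area 11139/2500
  have hP3 := trapezoid_subset_of_convex hconv (by norm_num) m2 n2 m3 n3
  have hV3 := volume_trapezoid (x₀ := 31/50) (x₁ := 11/5) (y₀ := 11/5) (y₁ := 31/50)
    (by norm_num) (by norm_num) (by norm_num)
  -- disjoint union, left to right
  have hU := trapezoid_union_step (U := (∅ : Set (ℝ × ℝ))) (s := -(11/5)) (Set.empty_subset _)
    (Set.empty_subset _) (by rw [measure_empty, ENNReal.ofReal_zero]) le_rfl hP1
    (regionBetween_subset _ _ _) (measurableSet_trapezoid _ _ _ _) hV1 (by norm_num) (by norm_num)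
  have hU := trapezoid_union_step hU.1 hU.2.1 hU.2.2.1 hU.2.2.2 hP2 (regionBetween_subset _ _ _)
    (measurableSet_trapezoid _ _ _ _) hV2 (by norm_num) (by norm_num)
  have hU := trapezoid_union_step hU.1 hU.2.1 hU.2.2.1 hU.2.2.2 hP3 (regionBetween_subset _ _ _)
    (measurableSet_trapezoid _ _ _ _) hV3 (by norm_num) (by norm_num)
  -- conclusion
  have h := measure_mono (μ := volume) hU.1
  rw [hU.2.2.1] at h
  refine le_trans (le_of_eq ?_) h
  congr 1
  norm_num

/-- The occupied volume at energy `-21/50` is at least `17959/1250`. [folklore] -/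
theorem klwL_le_volume_occupied :
    ENNReal.ofReal (17959 / 1250) ≤
      volume ({p : Momentum | squareDispersion 1 0 p < -(21 : ℝ) / 50} ∩ brillouinZone) := by
  refine klwL_le_volume_fermiSeaCoord.trans ((volume_fermiSeaCoord_le (21 / 100 : ℝ)).trans ?_)
  exact measure_mono (muWinL_fermiSea_mono (by norm_num))

/-- **Certified lower filling bound at the lower end of the door's level window**: `13/20 ≤ n(-21/50)`
(`vol ≥ 14.3672 > 1.3 π²`, `π < 3.1416`; true value `n(-0.42) = 0.8026`). [folklore] -/
theorem klwL_filling_ge :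
    (13 : ℝ) / 20 ≤ KohnLuttinger.filling (squareDispersion 1 0) (-(21 : ℝ) / 50) := by
  rw [kl_mu_filling_eq]
  have hV : (17959 : ℝ) / 1250 ≤
      (volume ({p : Momentum | squareDispersion 1 0 p < -(21 : ℝ) / 50} ∩ brillouinZone)).toReal :=
    (ENNReal.ofReal_le_iff_le_toReal (kl_mu_volume_occupied_lt_top _).ne).1 klwL_le_volume_occupied
  have hpi := Real.pi_lt_d4
  have hpi0 := Real.pi_pos
  have hpi2 : Real.pi * Real.pi < 3.1416 * 3.1416 := mul_self_lt_mul_self hpi0.le hpi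
  rw [le_div_iff₀ (by positivity)]
  nlinarith

end Summit.HubbardSuperconductivity.HubbardSuperconductivity.Theorems

end
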